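import Summits.BirchSwinnertonDyer.BirchSwinnertonDyer.Theorems.GenusKolyvaginAtTwoPowDvdShaCardAtTwoRTLocalKernelOneBitPadic
import Summits.BirchSwinnertonDyer.BirchSwinnertonDyer.Theorems.GenusKolyvaginAtTwoPowDvdShaCardAtTwoRTLocalKernelRelaxationIndex
import Literature.Barriers.BirchSwinnertonDyer.DescentDefectUnboundedMatsunoLemma41Proofs
import Literature.NumberTheory.NumberFields.CompletionLocalDegree
import Literature.NumberTheory.QuadraticFields.KroneckerSplitting
import Literature.AnabelianGeometry.AbsoluteAnabelian.NeukirchUchidaLocalInvariantsOmega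
import Mathlib.RingTheory.RamificationInertia.Basic
import HarnessLib

/-!
# Route `GenusKolyvaginAtTwo`, LINE 18 / LINE 19 (L_T stmt-BirchSwinnertonDyer-23242, L⁺_T stmt-23379): the binder
# `[K_w : ℚ_v] = 2` of the one-bit bound DISCHARGED for the Heegner field — at a prime `p` that does not split in the
# quadratic field `K` (in particular at a ramified `p ∣ d_K`) the completion `K_w` is quadratic over `ℚ_p`

Seat `bsd-line-gk2-p3` g17 (cell `bsd-f1-sign2`), `--supports stmt-BirchSwinnertonDyer-23242` (helper; closes nothing).
THEOREMS ONLY (no definition, no named fact, no `sorry`); BSD is not proved by any of this.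

The local theorems of this lineage (`…LocalKernelQuadratic`, `…TwoTorsionQuadratic`, `…LocalKernelOneBitLocal`,
`…LocalKernelOneBitPadic`, `…LocalKernelRelaxationIndex`) carry the binder
`Module.finrank (v.adicCompletion ℚ) (w.adicCompletion K) = 2` for the `ℚ_v`-algebra structure
`Literature.NumberTheory.EllipticCurves.adicCompletionMap` of Matsuno's `W_{v,K}`.  This file discharges it from the
data the LINE 18/19 skeletons actually quantify over (`K` imaginary quadratic, `p ∣ d_K` odd):

* §1 `finrank_adicCompletionMap_eq_ramificationIdx_mul_inertiaDeg` — `[K_w : ℚ_v] = e(w|p) · f(w|p)` (over `ℤ`) for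
  Matsuno's structure map: it IS the tree's local base change `SemiLocal.algebraPlace` (same definition), whose degree
  is the tree theorem `NumberFields.finrank_place_eq_ramificationIdx_mul_inertiaDeg` (Neukirch II (8.5)); the indices
  over `𝓞 ℚ` and over `ℤ` agree (tree `NeukirchUchidaProof.ramificationIdx_ringOfIntegersRat_eq_int'`,
  `…inertiaDeg_ringOfIntegersRat_eq_int'`, the public copies of the private lemmas of `CompletionLocalDegree`).
* §2 `ramificationIdx_mul_inertiaDeg_eq_two_of_ncard_primesOver_ne_two` — in a quadratic field, at a prime `p` with
  `#{𝔭 ∣ p} ≠ 2` (non-split: ramified or inert) the unique `𝔭 ∣ p` has `e f = 2` (`Σ_{𝔭 ∣ p} e f = [K : ℚ] = 2`,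
  Mathlib `Ideal.sum_ramification_inertia_eq_finrank`); `ncard_primesOver_ne_two_of_dvd_discr` — a ramified odd
  `p ∣ d_K` does not split (`(d_K / p) = 0 ≠ 1`, tree `QuadraticFields.Quadratic.ncard_primesOver_eq_two_iff_legendreSym`).
* §3 `finrank_adicCompletion_primePlace_eq_two_of_ncard_ne_two`, `…_of_dvd_discr` — **`[K_w : ℚ_p] = 2`** at
  `v = Matsuno2009.primePlace p`; and the binder-free one-bit bounds for the Heegner field:
  `natCard_localKernel_le_natCard_twoTorsion_of_dvd_discr` (**`#W_{p,K} ≤ #E(ℚ_p)[2]` at every odd ramified `p ∣ d_K`**),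
  `relIndex_selmerLocalKer_le_natCard_twoTorsion_of_dvd_discr` (the Selmer-level cost), and for a globally minimal `W`
  with `p ∤ Δ_min`: `natCard_localKernel_le_ncard_roots_add_one_of_dvd_discr` (`≤ #{roots of ψ mod p} + 1 = #Ẽ(𝔽_p)[2]`).

References: [NeukirchANT1999] Ch. II (8.5); [Kramer1981] §2 Prop. 3; [Matsuno2009] §3; Marcus, *Number Fields*, Ch. 3
Thm. 25 (splitting in quadratic fields).
-/

set_option autoImplicit false
-- the Theorems namespace of this sub repeats the summit name by design (D-0017 nested layout)
set_option linter.dupNamespace false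

noncomputable section

open scoped Classical

namespace Summit.BirchSwinnertonDyer.BirchSwinnertonDyer.Theorems.GenusExact.PlusDescent

open WeierstrassCurve NumberField IsDedekindDomain Literature.NumberTheory.EllipticCurves
  Literature.Barriers.BirchSwinnertonDyer Literature.NumberTheory.GaloisRepresentations.SemiLocal

/-! ## §1 `[K_w : ℚ_v] = e · f` for Matsuno's structure map -/

section Degree

/-- **`[K_w : ℚ_v] = e(w|p) · f(w|p)` for Matsuno's structure map.**  For a number field `K`, a finite place `v` of
`ℚ` and `w ∣ v`: the completion `K_w`, as a `ℚ_v`-algebra through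
`Literature.NumberTheory.EllipticCurves.adicCompletionMap` (the structure used by `Matsuno2009.localKernel`), has
degree `e(w|ℤ) · f(w|ℤ)`.  That map IS the tree's local base change `adicCompletionOfLiesOver`
(`SemiLocal.algebraPlace` at the place `⟨w⟩` above `v`), so this is `NumberFields.finrank_place_eq_ramificationIdx_mul_inertiaDeg`
(Neukirch II (8.5)) with the indices moved from `𝓞 ℚ` to `ℤ` (`NeukirchUchidaProof.ramificationIdx_ringOfIntegersRat_eq_int'`,
`…inertiaDeg_ringOfIntegersRat_eq_int'`). [cite: NeukirchANT1999, Ch. II Prop. (8.5)] -/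
theorem finrank_adicCompletionMap_eq_ramificationIdx_mul_inertiaDeg (K : Type) [Field K] [NumberField K]
    (v : HeightOneSpectrum (𝓞 ℚ)) (w : HeightOneSpectrum (𝓞 K)) [h : w.asIdeal.LiesOver v.asIdeal] :
    letI : Algebra (v.adicCompletion ℚ) (w.adicCompletion K) :=
      (Literature.NumberTheory.EllipticCurves.adicCompletionMap (K := ℚ) K v w).toAlgebra
    Module.finrank (v.adicCompletion ℚ) (w.adicCompletion K) =
      w.asIdeal.ramificationIdx ℤ * w.asIdeal.inertiaDeg ℤ := by
  haveI : w.asIdeal.IsMaximal := w.isMaximal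
  have h1 := Literature.NumberTheory.NumberFields.finrank_place_eq_ramificationIdx_mul_inertiaDeg
    (⟨w, HeightOneSpectrum.ext h.over.symm⟩ : Place ℚ K v)
  rw [Literature.AnabelianGeometry.AbsoluteAnabelian.NeukirchUchidaProof.ramificationIdx_ringOfIntegersRat_eq_int',
    Literature.AnabelianGeometry.AbsoluteAnabelian.NeukirchUchidaProof.inertiaDeg_ringOfIntegersRat_eq_int'] at h1
  exact h1

end Degree

/-! ## §2 Quadratic fields: `e f = 2` at a non-split prime -/

section QuadraticField

variable {K : Type} [Field K] [NumberField K]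

/-- **`e(𝔭|p) f(𝔭|p) = 2` at a non-split prime of a quadratic field.** For `[K : ℚ] = 2`, a rational prime `p` with
`#{𝔭 ∣ p} ≠ 2` and a prime `𝔭` of `𝓞 K` over `(p)`: `e(𝔭|ℤ) · f(𝔭|ℤ) = 2`.  Proof: `Σ_{𝔭 ∣ p} e f = [𝓞 K : ℤ] = 2`
(Mathlib `Ideal.sum_ramification_inertia_eq_finrank`, `RingOfIntegers.rank`), every term is `≥ 1`, so `#{𝔭 ∣ p} ≤ 2`;
not `2` and not `0` means one prime, whose term is the whole sum. Marcus, *Number Fields*, Ch. 3 Thm. 21/25.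
[folklore] -/
theorem ramificationIdx_mul_inertiaDeg_eq_two_of_ncard_primesOver_ne_two (h2 : Module.finrank ℚ K = 2) {p : ℕ}
    (hp : p.Prime) (hns : ((Ideal.span {(p : ℤ)}).primesOver (𝓞 K)).ncard ≠ 2)
    (P : Ideal (𝓞 K)) [P.IsPrime] [hP : P.LiesOver (Ideal.span {(p : ℤ)})] :
    P.ramificationIdx ℤ * P.inertiaDeg ℤ = 2 := by
  haveI hprime : (Ideal.span {(p : ℤ)}).IsPrime :=
    (Ideal.span_singleton_prime (by exact_mod_cast hp.ne_zero)).mpr (Nat.prime_iff_prime_int.mp hp)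
  haveI : (Ideal.span {(p : ℤ)}).IsMaximal :=
    hprime.isMaximal (by rw [Ne, Ideal.span_singleton_eq_bot]; exact_mod_cast hp.ne_zero)
  set S := (Ideal.span {(p : ℤ)}).primesOver (𝓞 K) with hSdef
  have hsum := Ideal.sum_ramification_inertia_eq_finrank (Ideal.span {(p : ℤ)}) (𝓞 K)
  rw [RingOfIntegers.rank, h2] at hsum
  have hmem : P ∈ S := ⟨inferInstance, hP⟩
  -- every term is `≥ 1`, so `#S ≤ 2`; `#S ≥ 1`; `#S ≠ 2`; hence `#S = 1`
  have hpos : ∀ q : S, 1 ≤ q.1.ramificationIdx ℤ * q.1.inertiaDeg ℤ := by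
    intro q
    haveI : q.1.IsPrime := q.2.1
    exact Nat.one_le_iff_ne_zero.mpr (mul_ne_zero (Ideal.ramificationIdx_pos q.1 ℤ).ne' (Ideal.inertiaDeg_pos q.1 ℤ).ne')
  have hcard_le : Fintype.card S ≤ 2 := by
    have h := Finset.card_nsmul_le_sum (Finset.univ : Finset S) (fun q ↦ q.1.ramificationIdx ℤ * q.1.inertiaDeg ℤ) 1
      fun q _ ↦ hpos q
    rw [smul_eq_mul, mul_one, hsum] at h
    exact h
  have hcard_pos : 0 < Fintype.card S := Fintype.card_pos_iff.mpr ⟨⟨P, hmem⟩⟩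
  have hncard : S.ncard = Fintype.card S := by rw [← Nat.card_coe_set_eq, Nat.card_eq_fintype_card]
  have hcard : Fintype.card S = 1 := by
    rw [hncard] at hns
    omega
  -- the sum is the single term at `P`
  obtain ⟨q₀, hq₀⟩ := Fintype.card_eq_one_iff.mp hcard
  have hPq : (⟨P, hmem⟩ : S) = q₀ := hq₀ _
  rw [Fintype.sum_eq_single (⟨P, hmem⟩ : S) (fun q hq ↦ absurd ((hq₀ q).trans hPq.symm) hq)] at hsum
  exact hsum

/-- **A ramified odd prime does not split**: for `[K : ℚ] = 2` and an odd prime `p ∣ d_K`, `#{𝔭 ∣ p} ≠ 2` (the tree's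
decomposition law `QuadraticFields.Quadratic.ncard_primesOver_eq_two_iff_legendreSym`: `p` splits iff `(d_K / p) = 1`, while
`(d_K / p) = 0`). Marcus, *Number Fields*, Ch. 3 Thm. 25. [folklore] -/
theorem ncard_primesOver_ne_two_of_dvd_discr (h2 : Module.finrank ℚ K = 2) {p : ℕ} (hp : p.Prime) (hp2 : p ≠ 2)
    (hpd : (p : ℤ) ∣ NumberField.discr K) : ((Ideal.span {(p : ℤ)}).primesOver (𝓞 K)).ncard ≠ 2 := by
  haveI := Fact.mk hp
  rw [Ne, Literature.NumberTheory.QuadraticFields.Quadratic.ncard_primesOver_eq_two_iff_legendreSym h2 hp2,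
    (legendreSym.eq_zero_iff p (NumberField.discr K)).mpr
      ((ZMod.intCast_zmod_eq_zero_iff_dvd _ p).mpr hpd)]
  exact zero_ne_one

/-- **An inert prime does not split**: for `[K : ℚ] = 2` and an odd prime `p` with `(d_K / p) = -1`, `#{𝔭 ∣ p} ≠ 2`.
Marcus, *Number Fields*, Ch. 3 Thm. 25. [folklore] -/
theorem ncard_primesOver_ne_two_of_legendreSym_eq_neg_one (h2 : Module.finrank ℚ K = 2) {p : ℕ} [Fact p.Prime]
    (hp2 : p ≠ 2) (hJ : legendreSym p (NumberField.discr K) = -1) :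
    ((Ideal.span {(p : ℤ)}).primesOver (𝓞 K)).ncard ≠ 2 := by
  rw [Ne, Literature.NumberTheory.QuadraticFields.Quadratic.ncard_primesOver_eq_two_iff_legendreSym h2 hp2, hJ]
  decide

end QuadraticField

/-! ## §3 `[K_w : ℚ_p] = 2` at a non-split prime, and the binder-free one-bit bounds for the Heegner field -/

section Heegner

variable {K : Type} [Field K] [NumberField K] {p : ℕ}
  (w : HeightOneSpectrum (𝓞 K)) [w.asIdeal.LiesOver (Matsuno2009.primePlace p).asIdeal]

/-- **`[K_w : ℚ_p] = 2` at a non-split prime of a quadratic field**, for the place `w ∣ p` and Matsuno's structure map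
on `K_w` over `ℚ_v`, `v = Matsuno2009.primePlace p` (§1 + §2; `w ∣ (p) ⊆ ℤ` by
`Matsuno2009.liesOver_span_of_liesOver_primePlace`). [cite: NeukirchANT1999, Ch. II Prop. (8.5)] -/
theorem finrank_adicCompletion_primePlace_eq_two_of_ncard_ne_two (h2 : Module.finrank ℚ K = 2) (hp : p.Prime)
    (hns : ((Ideal.span {(p : ℤ)}).primesOver (𝓞 K)).ncard ≠ 2) :
    letI : Algebra ((Matsuno2009.primePlace p).adicCompletion ℚ) (w.adicCompletion K) :=
      (Literature.NumberTheory.EllipticCurves.adicCompletionMap (K := ℚ) K (Matsuno2009.primePlace p) w).toAlgebra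
    Module.finrank ((Matsuno2009.primePlace p).adicCompletion ℚ) (w.adicCompletion K) = 2 := by
  haveI := Matsuno2009.liesOver_span_of_liesOver_primePlace K hp w
  haveI : w.asIdeal.IsPrime := w.isPrime
  have h := finrank_adicCompletionMap_eq_ramificationIdx_mul_inertiaDeg K (Matsuno2009.primePlace p) w
  rw [ramificationIdx_mul_inertiaDeg_eq_two_of_ncard_primesOver_ne_two h2 hp hns w.asIdeal] at h
  exact h

/-- **`[K_𝔭 : ℚ_p] = 2` at an odd ramified prime `p ∣ d_K` of a quadratic field** — the binder of the LINE 18/19 local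
lemmas, for the Heegner field and `p ∣ d_K`. [cite: NeukirchANT1999, Ch. II Prop. (8.5)] -/
theorem finrank_adicCompletion_primePlace_eq_two_of_dvd_discr (h2 : Module.finrank ℚ K = 2) (hp : p.Prime)
    (hp2 : p ≠ 2) (hpd : (p : ℤ) ∣ NumberField.discr K) :
    letI : Algebra ((Matsuno2009.primePlace p).adicCompletion ℚ) (w.adicCompletion K) :=
      (Literature.NumberTheory.EllipticCurves.adicCompletionMap (K := ℚ) K (Matsuno2009.primePlace p) w).toAlgebra
    Module.finrank ((Matsuno2009.primePlace p).adicCompletion ℚ) (w.adicCompletion K) = 2 :=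
  finrank_adicCompletion_primePlace_eq_two_of_ncard_ne_two w h2 hp (ncard_primesOver_ne_two_of_dvd_discr h2 hp hp2 hpd)

variable (E : WeierstrassCurve ℚ) [E.IsElliptic] (K)

/-- **`#W_{p,K} ≤ #E(ℚ_p)[2]` at every odd ramified prime `p ∣ d_K` of a quadratic field `K`** (no further binder): for
`E/ℚ` elliptic, `[K : ℚ] = 2`, `p` an odd prime dividing `d_K` and `w` the place of `K` above `p`, Matsuno's
`W_{p,K} = ker(H¹(ℚ_p, E) → H¹(K_w, E))` is finite of order `≤ #E(ℚ_p)[2]` (points over the tree's `ℚ_v`,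
`v = Matsuno2009.primePlace p`).  Kramer 1981 Prop. 3 (upper half) for the Heegner field of LINE 18/19.
[cite: Kramer1981, §2 Prop. 3] [cite: Matsuno2009, §3 (p. 451, W_{v,K})] -/
theorem natCard_localKernel_le_natCard_twoTorsion_of_dvd_discr (h2 : Module.finrank ℚ K = 2) (hp : p.Prime)
    (hp2 : p ≠ 2) (hpd : (p : ℤ) ∣ NumberField.discr K) :
    Finite (Matsuno2009.localKernel E K (Matsuno2009.primePlace p) w) ∧
      Nat.card (Matsuno2009.localKernel E K (Matsuno2009.primePlace p) w) ≤
        Nat.card {P : (E.baseChange ((Matsuno2009.primePlace p).adicCompletion ℚ)).toAffine.Point // 2 • P = 0} :=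
  haveI := Fact.mk hp
  natCard_localKernel_le_natCard_twoTorsion E K (Matsuno2009.primePlace p) w
    (finrank_adicCompletion_primePlace_eq_two_of_dvd_discr w h2 hp hp2 hpd)
    (two_not_mem_of_liesOver_primePlace K w hp2)

/-- **The Selmer-level cost at an odd ramified `p ∣ d_K`**: `[K_w-condition : ℚ_p-condition] ≤ #E(ℚ_p)[2]` on
`H¹(ℚ, E[n])`, every level `n` (`relIndex_selmerLocalKer_le_natCard_twoTorsion` with the binders discharged).
[cite: Kramer1981, §2 Prop. 3] [cite: Matsuno2009, §3 and Prop. 3.2] -/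
theorem relIndex_selmerLocalKer_le_natCard_twoTorsion_of_dvd_discr (h2 : Module.finrank ℚ K = 2) (hp : p.Prime)
    (hp2 : p ≠ 2) (hpd : (p : ℤ) ∣ NumberField.discr K) (n : ℤ) :
    (selmerLocalKer E ((Matsuno2009.primePlace p).adicCompletion ℚ) n).relIndex
        (selmerLocalKer E (w.adicCompletion K) n) ≤
      Nat.card {P : (E.baseChange ((Matsuno2009.primePlace p).adicCompletion ℚ)).toAffine.Point // 2 • P = 0} :=
  haveI := Fact.mk hp
  relIndex_selmerLocalKer_le_natCard_twoTorsion E K (Matsuno2009.primePlace p) w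
    (finrank_adicCompletion_primePlace_eq_two_of_dvd_discr w h2 hp hp2 hpd)
    (two_not_mem_of_liesOver_primePlace K w hp2) n

/-- **`#W_{p,K} ≤ #{roots of ψ mod p} + 1 = #Ẽ(𝔽_p)[2]` at an odd ramified `p ∣ d_K` of good reduction**, for `W/ℚ`
globally minimal (`p ∤ Δ_min(W)`) and `[K : ℚ] = 2`: the one-bit bound in the cell's DEF currency with every local binder
discharged (`natCard_localKernel_le_ncard_roots_add_one`). [cite: Kramer1981, §2 Prop. 3]
[cite: MazurRubin2010, Lemma 2.2 (i)] -/
theorem natCard_localKernel_le_ncard_roots_add_one_of_dvd_discr (W : WeierstrassCurve ℚ) [W.IsElliptic]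
    [W.IsGloballyMinimal] (h2 : Module.finrank ℚ K = 2) (hp : p.Prime) (hp2 : p ≠ 2)
    (hpd : (p : ℤ) ∣ NumberField.discr K) (hpΔ : ¬ (p : ℤ) ∣ minimalDiscriminantInt W) :
    Finite (Matsuno2009.localKernel W K (Matsuno2009.primePlace p) w) ∧
      Nat.card (Matsuno2009.localKernel W K (Matsuno2009.primePlace p) w) ≤
        {x : ZMod p | 4 * x ^ 3 + ((integralModelInt W).b₂ : ZMod p) * x ^ 2 +
          2 * ((integralModelInt W).b₄ : ZMod p) * x + ((integralModelInt W).b₆ : ZMod p) = 0}.ncard + 1 :=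
  haveI := Fact.mk hp
  natCard_localKernel_le_ncard_roots_add_one W K w hp2 hpΔ
    (finrank_adicCompletion_primePlace_eq_two_of_dvd_discr w h2 hp hp2 hpd)

end Heegner

end Summit.BirchSwinnertonDyer.BirchSwinnertonDyer.Theorems.GenusExact.PlusDescent

end
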